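import Summits.QuantumFields.YangMills.Theorems.BalabanUVNodesN11NoExpansionGeneralStep
import Summits.QuantumFields.YangMills.Theorems.BalabanUVNodesN11NoExpansionDiagonalCoPH
import Summits.QuantumFields.YangMills.Theorems.BalabanUVNodesN11NoExpansionActionSucc
import Summits.QuantumFields.YangMills.Theorems.BalabanUVNodesN11BackgroundScaleLocal

/-!
# DAG node N11 — «THE OLD FACTORS AGREE» AT A NO-EXPANSION STEP AFTER AN ARBITRARY HISTORY ((3.24), DERIVED), AND THE ASSEMBLED 𝐓-STEP: for every old branch
# `S`, `𝐓_k(init s′, S)[e^{A_{k+1}(s′)}] (U, V′) = e^{E_k − E_{k+1}}·𝐓_k(init s′, S)[e^{A_k(init s′)}] (U)` from (2.22) (p531413: no new term at a no-expansion step),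
# def-R's unchanged background (p526149), linearity and scale-locality of 11a's branch operator (p527289), def-R's scale-local background (p536754) and the
# DISPLAYED scale-locality of the weights below `k` and of the old action in its fluctuation argument; then the clause-keyed general step, also at two weight
# families agreeing below `k`, and at the v1.7 `CoPH` record (`θ.zhAt p s′` ∕ `θ.zhAt p (init s′)`, history's residual `θ.rzAt p s′`)

Cell `pub-ymgap`, YM-PLAN Track A (HUMAN RULING D-0062), seat `pub-ymgap-dag-n11-d` (g8; R134 fan-out seat N11 [B14], strategy s2), route `BalabanUVNodes`
rev 23→24, item K1⁶ `StabilityBAtRecordR13SepCoPR` = stmt-QuantumFields-20507 (helper, count-neutral; ⁷ re-key by name at KEY-24).  [III] = [Balaban1988Convergent].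
Sequel of `…NoExpansionGeneralStep` (g8: the step at a no-expansion new sequence after ANY history, modulo displayed (3.24) `hbranch` and the generation-`k` spec
with `χ_k`) over `…NoExpansionActionSucc` (p531413), `…NoExpansionAtRecord13CoP` (p526149, `UbgOfRecord₁₃CoP_succ_eq_init_of_Omega_empty` ∕ `_one_eq_init_…`),
`…TkBranchLinearLocal` (p527289, (L)+(SL)), `…BackgroundScaleLocal` (p536754, (BL)), `…TkBranchWeightCongr` (p536516, (PC)), `…NoExpansionDiagonalCoPH` (g8,
residual irrelevance) and node00-def-T's FILE 27 `Node00/Record13CoPH` (p537939).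

WHY THIS FILE.  g7 listed the five ingredients of the general-history no-expansion 𝐓-step; four were typed (ActionSucc, (L)+(SL), (PC), (BL)), the fifth —
scale-locality of the old operand in its fluctuation argument (the 𝐁-terms `t.B j X bg a` of (2.40) have no locality law in `Sect2.TermValues`) — stays
DISPLAYED (`hA`), as does the scale-locality of the A-side weights below generation `k` (`hwloc`: 12a's `chiAW_j` reads the scale-`j`∕`(j+1)` variables, `quad_j`
carries no locality law).  With these, (3.24) is a THEOREM at every no-expansion step (§1), the general step is assembled (§2), transported across two weight
families agreeing below `k` (§3: the v1.7 situation — director-ym №186 (2)'s «components untouched by R^{(k+1)}»); the sequel instantiates it at the `CoPH` record,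
where `θ.zhAt p s′` must carry the generation-`k` pin WITH THE OLD FRONT FACTOR, `ζ0_k(T)(U, V′)·e^{−quad_k(∅)∕2} = χ_k(Ω_k(init s′))(U)·w_k(s′)(U, Ū)` — the
history-indexed VALUE the v1.7 slot exists to carry (H3, node00-def-K0a∕K0b's lane; a HYPOTHESIS there).

WHAT THIS FILE PROVES (0 `sorry`, 0 `def`, standard axioms; `N`-generic).  §1 `action23_congr_fluct_of_B_local` (`hA` ⟸ scale-locality of `t.B`) · ★ `oldFactors_agree_of_Omega_empty` (generic weight family `W`, θ : Stage13Params,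
backgrounds `UbgOfRecord₁₃CoP θ p (k+1) s′` ∕ `… k (init s′)`, any residual pair; hypotheses `1 ≤ M`, `Ω_{k+1}(s′) = ∅`, `hζloc`, `hwloc`, `hA`; constant
`e^{E_k − E_{k+1}}`).  §2 ★★ `clause_succ_of_Omega_empty_of_pinChi_of_clause` (the general clause-keyed step at ONE weight family: `hid` at `init s′` ⇒ the
𝐓-image clause at `s′`, same witness `t`, same constant; pin `hζχ` with `c = 1`).  §3 ★★ `clause_succ_of_Omega_empty_of_prefix_of_clause` (two weight families
`W` (new) ∕ `W₀` (old) with `∀ j < k, W.ζ j = W₀.ζ j ∧ W.w j = W₀.w j`; `hid` at `W₀`).  The v1.7 `CoPH` instance (`θ.zhAt p s′` ∕ `θ.zhAt p (init s′)`, the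
history's residual) is the sequel `…NoExpansionGeneralStepCoPH`.

HONEST FRAMING ∕ A6 (director-ym №189 (3)).  Count-neutral kernel bookkeeping on the tree's OWN objects; displayed binders: `hwloc`, `hA` (locality PROPERTIES of
the record's weights ∕ of the witness's 𝐁-terms — not exhibited; true at the all-large-field history trivially, where this seat's `…DiagonalCoPHSucc` needs neither),
the pin `hζχ`∕`hZ`+`hq` (at `Ω_k(init s′) = ∅` it is the diagonal pin, inhabited by K0a's cured residual at the door; in general a VALUE statement, H3), `hpre`
(`rfl` at the door), `hid` (the clause of `SLaw k`), `hm`∕`hC` (measurability ∕ bound of the new integrand — properties, not exhibited).  NOT `TLaw k` (sequences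
with `Ω_{k+1}(s′) ≠ ∅` are [III] §3 + Thm 2 proper), NOT a witness; nothing of Bałaban's asserted; N11 NOT discharged; counts unmoved (typed 28∕28 · discharged
5∕28).  One finite four-torus programme at fixed `ε = L^{−K}`; NOT ℝ⁴, NOT OS, NOT a mass gap, NOT Clay.
Sources: [III] (2.18) p.257, (2.20)–(2.25) pp.258–259, (2.30) p.260, (2.40)–(2.41) p.261, (3.1) p.264, (3.16) p.268, (3.21) p.269, (3.24)–(3.25) p.270,
Theorem p.245, Thm 1 p.262; [IV] (0.2)–(0.3) p.176.
-/

noncomputable section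

open MeasureTheory
open scoped BigOperators Matrix.Norms.L2Operator

namespace Summit.QuantumFields.YangMills.Theorems.BalabanUVNodesN11NoExpansionOldFactors

open Literature.MathematicalPhysics.QuantumFieldTheory.Balaban1983to89 T4Continuum Node00 Node00.Tk DagBinding
open B15DeterminingSets
open BalabanUVNodesN11NoExpansionActionSucc (exp_action23_succ_eq_init_of_Omega_empty)
open BalabanUVNodesN11NoExpansionAtRecord13CoP (UbgOfRecord₁₃CoP_succ_eq_init_of_Omega_empty UbgOfRecord₁₃CoP_one_eq_init_of_Omega_empty)
open BalabanUVNodesN11TkBranchLinearLocal (tkBranchOfRecord_const_mul tkBranchOfRecord_pairCfgAt_eq_baseCfg)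
open BalabanUVNodesN11BackgroundScaleLocal (UbgOfRecord₁₃CoP_congr_of_agree_le)
open BalabanUVNodesN11TkBranchWeightCongr (sect2Slot_congr_of_weights tkWeightsOfRecordP_ζ_congr tkWeightsOfRecordP_w_congr)
open BalabanUVNodesN11NoExpansionGeneralStep (clause_succ_of_zetaSpecChiAt_of_clause)
open BalabanUVNodesN11NoExpansionDiagonalCoPH (sect2Slot_congr_residual sect2Operand_congr_residual WtOfRecord₁₃H_eq_tkWeightsOfRecordP)

variable {F : T4Family} {N : ℕ} [NeZero N]

/-! ## §1. ★ (3.24) derived: the old factors agree at a no-expansion step after any history -/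

section OldFactors

variable (θ : Stage13Params F N) (p : B12.RunParams)

/-- **def-R's `CoP` BACKGROUND MAP IS UNCHANGED ALONG A NO-EXPANSION STEP, POINTWISE, EVERY `k`** (p526149's `k ≥ 1` equation and `k = 0` face together).
[cite: Balaban1988Convergent, (2.12)–(2.13) pp.256–257, Thm 1 p.262] -/
theorem UbgOfRecord₁₃CoP_succ_apply_eq_init_of_Omega_empty {k : ℕ}
    (s : SeqOfRecord F θ.ν θ.τ9.M (gOfRecord₁₃ F N θ p) p.K (k + 1)) (hΩ : s.Ω (k + 1) = ∅) (W : MSField (F.P p.K) (SU N)) :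
    UbgOfRecord₁₃CoP F N θ p (k + 1) s W = UbgOfRecord₁₃CoP F N θ p k s.init W := by
  rcases Nat.eq_zero_or_pos k with hk0 | hkpos
  · subst hk0
    exact UbgOfRecord₁₃CoP_one_eq_init_of_Omega_empty θ p s hΩ W
  · rw [UbgOfRecord₁₃CoP_succ_eq_init_of_Omega_empty θ p hkpos s hΩ]

/-- **THE NEW OPERAND IS A CONSTANT MULTIPLE OF THE OLD ONE at a no-expansion step, any history, SAME witness** (p531413's (2.22) + the unchanged background):
`e^{A_{k+1}(s′)[t, a](U_{k+1}(s′)(𝐖))} = e^{E_k − E_{k+1}}·e^{A_k(init s′)[t, a](U_k(init s′)(𝐖))}` (`M ≥ 1`; any two residual data, by residual irrelevance).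
[cite: Balaban1988Convergent, (2.22)–(2.23) p.258, (3.24) p.270] -/
theorem sect2Operand_succ_eq_const_mul_of_Omega_empty (hM : 1 ≤ θ.τ9.M) {k : ℕ}
    (s : SeqOfRecord F θ.ν θ.τ9.M (gOfRecord₁₃ F N θ p) p.K (k + 1)) (hΩ : s.Ω (k + 1) = ∅)
    (Rz Rz' : Sect2.Residual (F.P p.K) (MatA N)) (t : Sect2.TermValues (F.P p.K) (MatA N) (FluctV N) θ.τ9.M) (Ek Ek' : ℝ)
    (a : Tk.SFluct (F.P p.K) (FluctV N)) (W : MSField (F.P p.K) (SU N)) :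
    sect2Operand F N (FluctV N) p.K (settingOfRecord₁₃ F N θ p) Rz' s t Ek' (UbgOfRecord₁₃CoP F N θ p (k + 1) s) a W =
      Real.exp (Ek - Ek') * sect2Operand F N (FluctV N) p.K (settingOfRecord₁₃ F N θ p) Rz s.init t Ek (UbgOfRecord₁₃CoP F N θ p k s.init) a W := by
  rw [sect2Operand_congr_residual (settingOfRecord₁₃ F N θ p) Rz' Rz s t Ek' (UbgOfRecord₁₃CoP F N θ p (k + 1) s)]
  show Real.exp ((sect2ActionDataOfRecord F N (FluctV N) p.K (settingOfRecord₁₃ F N θ p) Rz s t a Ek').action23 (k + 1)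
      (UbgOfRecord₁₃CoP F N θ p (k + 1) s W)) =
    Real.exp (Ek - Ek') * Real.exp ((sect2ActionDataOfRecord F N (FluctV N) p.K (settingOfRecord₁₃ F N θ p) Rz s.init t a Ek).action23 k
      (UbgOfRecord₁₃CoP F N θ p k s.init W))
  rw [UbgOfRecord₁₃CoP_succ_apply_eq_init_of_Omega_empty θ p s hΩ W]
  exact exp_action23_succ_eq_init_of_Omega_empty (settingOfRecord₁₃ F N θ p) Rz hM s hΩ t a Ek Ek' _

/-- **THE (2.23) ACTION IS `k`-LOCAL IN THE FLUCTUATION ARGUMENT WHEN THE 𝐁-TERMS ARE**: only (2.40)'s `𝐁_k(U, A) = Σ_{j ≤ k} Σ_X 𝐁^{(j)}(X, U, A, {S_i ∩ X})`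
reads the fluctuation variables, so if the witness's `𝐁^{(j)}`, `1 ≤ j ≤ n`, read `A_i`, `i ≤ n` only (`hB` — the displayed scale-locality LAW a future row on
`Sect2.TermValues` would state), two fluctuation arguments agreeing on the scales `≤ n` give the same action.  Reduces `hA` below to a property of `t.B`.
[cite: Balaban1988Convergent, (2.23) p.258, (2.40)–(2.41) p.261] -/
theorem action23_congr_fluct_of_B_local {n : ℕ} {ν : Stage7Numerics} {M : ℕ} {g : ℕ → ℝ} {K : ℕ} (S' : Sect2.Setting (MatA N) (SU N))
    (Rz : Sect2.Residual (F.P K) (MatA N)) (s : SeqOfRecord F ν M g K n) (t : Sect2.TermValues (F.P K) (MatA N) (FluctV N) M) (Ek : ℝ)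
    (S : ℕ → Set (Site (F.P K) 0))
    (hB : ∀ j, 1 ≤ j → j ≤ n → ∀ (X : (Sect2.domSys (F.P K) M j).Dom) (u : Sect2.CPair (F.P K) (MatA N)) (a a' : Tk.MSFluct (F.P K) (FluctV N)),
      (∀ i, i ≤ n → a i = a' i) → t.B j X u (S, a) = t.B j X u (S, a'))
    (a a' : Tk.MSFluct (F.P K) (FluctV N)) (h : ∀ i, i ≤ n → a i = a' i) (U : GaugeField (F.P K) 0 (SU N)) :
    (sect2ActionDataOfRecord F N (FluctV N) K S' Rz s t (S, a) Ek).action23 n U = (sect2ActionDataOfRecord F N (FluctV N) K S' Rz s t (S, a') Ek).action23 n U := by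
  show (Sect2.actionDataOfTerms S' Rz ν M g s.Ω s.Λ t n (S, a) Ek).action23 n U = (Sect2.actionDataOfTerms S' Rz ν M g s.Ω s.Λ t n (S, a') Ek).action23 n U
  rw [Sect2.action23_actionDataOfTerms, Sect2.action23_actionDataOfTerms]
  congr 2
  unfold B14.Eq225Concrete.B240
  refine Finset.sum_congr rfl fun j hj => Finset.sum_congr rfl fun X _ => ?_
  rw [Finset.mem_Icc] at hj
  split_ifs
  · exact congrArg Complex.re (hB j hj.1 hj.2 X _ a a' h)
  · rfl

/-- **THE OLD OPERAND IS `k`-LOCAL in the all-scales configuration** when its action is `k`-local in the fluctuation argument (`hA`, displayed: the 𝐁-terms) — the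
background `U_k(init s′)(𝐖)` reads `𝐖 i`, `i ≤ k` only ((BL), p536754). [cite: Balaban1988Convergent, (2.23) p.258, (2.40) p.261, (2.12) p.256] -/
theorem sect2Operand_old_local {k : ℕ} (s : SeqOfRecord F θ.ν θ.τ9.M (gOfRecord₁₃ F N θ p) p.K (k + 1))
    (Rz : Sect2.Residual (F.P p.K) (MatA N)) (t : Sect2.TermValues (F.P p.K) (MatA N) (FluctV N) θ.τ9.M) (Ek : ℝ) (S : ℕ → Set (Site (F.P p.K) 0))
    (hA : ∀ (a a' : Tk.MSFluct (F.P p.K) (FluctV N)) (Uf : GaugeField (F.P p.K) 0 (SU N)), (∀ i, i ≤ k → a i = a' i) →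
      (sect2ActionDataOfRecord F N (FluctV N) p.K (settingOfRecord₁₃ F N θ p) Rz s.init t (S, a) Ek).action23 k Uf =
        (sect2ActionDataOfRecord F N (FluctV N) p.K (settingOfRecord₁₃ F N θ p) Rz s.init t (S, a') Ek).action23 k Uf)
    (ω ω' : MultiCfg (F.P p.K) (SU N) (FluctV N)) (h : ∀ i, i ≤ k → ω i = ω' i) :
    sect2Operand F N (FluctV N) p.K (settingOfRecord₁₃ F N θ p) Rz s.init t Ek (UbgOfRecord₁₃CoP F N θ p k s.init) (S, fun j => (ω j).2) (fun j => (ω j).1) =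
      sect2Operand F N (FluctV N) p.K (settingOfRecord₁₃ F N θ p) Rz s.init t Ek (UbgOfRecord₁₃CoP F N θ p k s.init) (S, fun j => (ω' j).2)
        (fun j => (ω' j).1) := by
  show Real.exp ((sect2ActionDataOfRecord F N (FluctV N) p.K (settingOfRecord₁₃ F N θ p) Rz s.init t (S, fun j => (ω j).2) Ek).action23 k
      (UbgOfRecord₁₃CoP F N θ p k s.init (fun j => (ω j).1))) =
    Real.exp ((sect2ActionDataOfRecord F N (FluctV N) p.K (settingOfRecord₁₃ F N θ p) Rz s.init t (S, fun j => (ω' j).2) Ek).action23 k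
      (UbgOfRecord₁₃CoP F N θ p k s.init (fun j => (ω' j).1)))
  rw [UbgOfRecord₁₃CoP_congr_of_agree_le θ p k s.init (W := fun j => (ω j).1) (W' := fun j => (ω' j).1) (fun i hi => by rw [h i hi]),
    hA (fun j => (ω j).2) (fun j => (ω' j).2) _ (fun i hi => by rw [h i hi])]

/-- **★ (3.24) DERIVED — «THE OLD FACTORS AGREE» AT A NO-EXPANSION STEP AFTER AN ARBITRARY HISTORY.**  For `s′` with `Ω_{k+1}(s′) = ∅`, any weight family `W`
whose `ζ_j`, `w_j` (`j < k`) are `k`-local (`hζloc`, `hwloc`), any witness `t` whose old action is `k`-local in the fluctuation argument (`hA`), constants `E_k`,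
`E_{k+1}`, any residual pair: for every old branch `S`, `𝐓_k(init s′, S)[e^{A_{k+1}(s′)}]_S (U, V′) = e^{E_k − E_{k+1}}·𝐓_k(init s′, S)[e^{A_k(init s′)}]_S (U)`.
(2.22) makes the operands proportional; (L) pulls the constant out; (SL) moves the two-scale configuration to the base one.
[cite: Balaban1988Convergent, (3.24) p.270, (2.20)–(2.23) p.258, (2.40) p.261] -/
theorem oldFactors_agree_of_Omega_empty (hM : 1 ≤ θ.τ9.M) {k : ℕ}
    (s : SeqOfRecord F θ.ν θ.τ9.M (gOfRecord₁₃ F N θ p) p.K (k + 1)) (hΩ : s.Ω (k + 1) = ∅) (W : TkWeights F N (FluctV N) p.K)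
    (hζloc : ∀ j, j < k → ∀ ω ω' : MultiCfg (F.P p.K) (SU N) (FluctV N), (∀ i, i ≤ k → ω i = ω' i) →
      W.ζ j (s.init.Ω (j + 1))ᶜ ω = W.ζ j (s.init.Ω (j + 1))ᶜ ω')
    (S : ℕ → Set (Site (F.P p.K) 0))
    (hwloc : ∀ j, j < k → ∀ ω ω' : MultiCfg (F.P p.K) (SU N) (FluctV N), (∀ i, i ≤ k → ω i = ω' i) →
      W.w j (s.init.Λ (j + 1)) ((s.init.Λ (j + 1))ᶜ ∩ s.init.Ω (j + 1)) (S (j + 1)) ω =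
        W.w j (s.init.Λ (j + 1)) ((s.init.Λ (j + 1))ᶜ ∩ s.init.Ω (j + 1)) (S (j + 1)) ω')
    (Rz Rz' : Sect2.Residual (F.P p.K) (MatA N)) (t : Sect2.TermValues (F.P p.K) (MatA N) (FluctV N) θ.τ9.M) (Ek Ek' : ℝ)
    (hA : ∀ (a a' : Tk.MSFluct (F.P p.K) (FluctV N)) (Uf : GaugeField (F.P p.K) 0 (SU N)), (∀ i, i ≤ k → a i = a' i) →
      (sect2ActionDataOfRecord F N (FluctV N) p.K (settingOfRecord₁₃ F N θ p) Rz s.init t (S, a) Ek).action23 k Uf =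
        (sect2ActionDataOfRecord F N (FluctV N) p.K (settingOfRecord₁₃ F N θ p) Rz s.init t (S, a') Ek).action23 k Uf)
    (V' : GaugeField (F.P p.K) (k + 1) (SU N)) (U₀ : GaugeField (F.P p.K) k (SU N)) :
    tkBranchOfRecord F N (FluctV N) θ.ν θ.τ9.M _ p.K W s.init S k
        (fun ω => sect2Operand F N (FluctV N) p.K (settingOfRecord₁₃ F N θ p) Rz' s t Ek' (UbgOfRecord₁₃CoP F N θ p (k + 1) s)
          (S, fun j => (ω j).2) (fun j => (ω j).1))
        (pairCfgAt (V := FluctV N) k V' U₀) =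
      Real.exp (Ek - Ek') * tkBranchOfRecord F N (FluctV N) θ.ν θ.τ9.M _ p.K W s.init S k
        (fun ω => sect2Operand F N (FluctV N) p.K (settingOfRecord₁₃ F N θ p) Rz s.init t Ek (UbgOfRecord₁₃CoP F N θ p k s.init)
          (S, fun j => (ω j).2) (fun j => (ω j).1))
        (baseCfg (V := FluctV N) k U₀) := by
  have hop : (fun ω : MultiCfg (F.P p.K) (SU N) (FluctV N) =>
        sect2Operand F N (FluctV N) p.K (settingOfRecord₁₃ F N θ p) Rz' s t Ek' (UbgOfRecord₁₃CoP F N θ p (k + 1) s)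
          (S, fun j => (ω j).2) (fun j => (ω j).1)) =
      fun ω => Real.exp (Ek - Ek') * sect2Operand F N (FluctV N) p.K (settingOfRecord₁₃ F N θ p) Rz s.init t Ek (UbgOfRecord₁₃CoP F N θ p k s.init)
          (S, fun j => (ω j).2) (fun j => (ω j).1) :=
    funext fun ω => sect2Operand_succ_eq_const_mul_of_Omega_empty θ p hM s hΩ Rz Rz' t Ek Ek' _ _
  rw [hop, tkBranchOfRecord_const_mul]
  congr 1
  exact tkBranchOfRecord_pairCfgAt_eq_baseCfg θ.ν θ.τ9.M _ p.K W s.init S hζloc hwloc (sect2Operand_old_local θ p s Rz t Ek S hA) V' U₀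

end OldFactors

/-! ## §2. ★★ The general clause-keyed no-expansion step at one weight family -/

section GeneralStep

variable (θ : Stage13Params F N) (p : B12.RunParams)

/-- **★★ THE NO-EXPANSION 𝐓-STEP AFTER AN ARBITRARY HISTORY, CLAUSE-KEYED, ONE WEIGHT FAMILY.**  `s′` with `Ω_{k+1}(s′) = ∅` (`k < K`, `1 ≤ M`); the §2 dichotomy of
`ρ_k`'s slot at `init s′` for the witness `(t, E₀, U_k(init s′))` and residual `Rz` (`hid`); the weights `k`-local below `k` (`hζloc`, `hwloc`), the old action `k`-local
in the fluctuation argument (`hA`); THE GENERATION-`k` PIN WITH THE OLD FRONT FACTOR on the averaging graph, `ζ_k(T)·w_k(∅,∅,∅)(U,Ū) = χ_k(init s′)(U)·w_k(s′)(U,Ū)`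
(`hζχ`); displayed joint measurability ∕ bound of the new integrand per old branch.  Then the 𝐓-image dichotomy holds at `s′` for THE SAME `t`, `E₀`, the background
`U_{k+1}(s′)` and any residual `Rz′`. [cite: Balaban1988Convergent, Theorem p.245, (3.24)–(3.25) p.270, (2.18) p.257, (2.20)–(2.23) p.258, (3.16) p.268] -/
theorem clause_succ_of_Omega_empty_of_pinChi_of_clause {k : ℕ} (hk : k < p.K) (hM : 1 ≤ θ.τ9.M)
    (s : SeqOfRecord F θ.ν θ.τ9.M (gOfRecord₁₃ F N θ p) p.K (k + 1)) (hΩ : s.Ω (k + 1) = ∅) (W : TkWeights F N (FluctV N) p.K)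
    (hζloc : ∀ j, j < k → ∀ ω ω' : MultiCfg (F.P p.K) (SU N) (FluctV N), (∀ i, i ≤ k → ω i = ω' i) →
      W.ζ j (s.init.Ω (j + 1))ᶜ ω = W.ζ j (s.init.Ω (j + 1))ᶜ ω')
    (hwloc : ∀ (S : ℕ → Set (Site (F.P p.K) 0)) (j : ℕ), j < k → ∀ ω ω' : MultiCfg (F.P p.K) (SU N) (FluctV N), (∀ i, i ≤ k → ω i = ω' i) →
      W.w j (s.init.Λ (j + 1)) ((s.init.Λ (j + 1))ᶜ ∩ s.init.Ω (j + 1)) (S (j + 1)) ω =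
        W.w j (s.init.Λ (j + 1)) ((s.init.Λ (j + 1))ᶜ ∩ s.init.Ω (j + 1)) (S (j + 1)) ω')
    (Rz Rz' : Sect2.Residual (F.P p.K) (MatA N)) (t : Sect2.TermValues (F.P p.K) (MatA N) (FluctV N) θ.τ9.M) (E₀ : ℝ)
    (hA : ∀ (S : ℕ → Set (Site (F.P p.K) 0)) (a a' : Tk.MSFluct (F.P p.K) (FluctV N)) (Uf : GaugeField (F.P p.K) 0 (SU N)), (∀ i, i ≤ k → a i = a' i) →
      (sect2ActionDataOfRecord F N (FluctV N) p.K (settingOfRecord₁₃ F N θ p) Rz s.init t (S, a) E₀).action23 k Uf =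
        (sect2ActionDataOfRecord F N (FluctV N) p.K (settingOfRecord₁₃ F N θ p) Rz s.init t (S, a') E₀).action23 k Uf)
    (hid : slotsOfRecord F N θ.ν θ.τ9 (EOfRecord₁₃ F N θ) (wOfRecord₉ F N θ.toStage9Params) θ.ppSel p (gOfRecord₁₃ F N θ p) k s.init = 0 ∨
      ∀ᵐ U₀ ∂fieldMeasure (F.P p.K) k (SU N),
        chiSeqOfRecord F N θ.ν θ.τ9.M (gOfRecord₁₃ F N θ p) p.K k s.init U₀ ≠ 0 →
          slotsOfRecord F N θ.ν θ.τ9 (EOfRecord₁₃ F N θ) (wOfRecord₉ F N θ.toStage9Params) θ.ppSel p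
              (gOfRecord₁₃ F N θ p) k s.init U₀ =
            sect2Slot F N (FluctV N) p.K (settingOfRecord₁₃ F N θ p) Rz W s.init t E₀ (UbgOfRecord₁₃CoP F N θ p k s.init) U₀)
    (hζχ : ∀ U₀ : GaugeField (F.P p.K) k (SU N),
      W.ζ k Set.univ (pairCfgAt (V := FluctV N) k ((avOfRecord F N p.K k).avg U₀) U₀) *
          W.w k ∅ ∅ ∅ (pairCfgAt (V := FluctV N) k ((avOfRecord F N p.K k).avg U₀) U₀) =
        chiSeqOfRecord F N θ.ν θ.τ9.M (gOfRecord₁₃ F N θ p) p.K k s.init U₀ *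
          wOfRecord₉ F N θ.toStage9Params p (gOfRecord₁₃ F N θ p) k s U₀ ((avOfRecord F N p.K k).avg U₀))
    {C : ℝ}
    (hm : ∀ S ∈ admSOfRecord F θ.ν θ.τ9.M (gOfRecord₁₃ F N θ p) p.K k s.init,
      Measurable (Function.uncurry (noExpIntegrandAt F N (FluctV N) p.K k W
        (tkBranchOfRecord F N (FluctV N) θ.ν θ.τ9.M _ p.K W s.init S k
          (fun ω => sect2Operand F N (FluctV N) p.K (settingOfRecord₁₃ F N θ p) Rz' s t E₀ (UbgOfRecord₁₃CoP F N θ p (k + 1) s)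
            (S, fun j => (ω j).2) (fun j => (ω j).1))))))
    (hC : ∀ S ∈ admSOfRecord F θ.ν θ.τ9.M (gOfRecord₁₃ F N θ p) p.K k s.init, ∀ V' U₀,
      |noExpIntegrandAt F N (FluctV N) p.K k W
        (tkBranchOfRecord F N (FluctV N) θ.ν θ.τ9.M _ p.K W s.init S k
          (fun ω => sect2Operand F N (FluctV N) p.K (settingOfRecord₁₃ F N θ p) Rz' s t E₀ (UbgOfRecord₁₃CoP F N θ p (k + 1) s)
            (S, fun j => (ω j).2) (fun j => (ω j).1)))
        V' U₀| ≤ C) :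
    slotsTOfRecord F N θ.ν θ.τ9 (EOfRecord₁₃ F N θ) (wOfRecord₉ F N θ.toStage9Params) θ.ppSel p (gOfRecord₁₃ F N θ p) (k + 1) s = 0 ∨
      ∀ᵐ V' ∂fieldMeasure (F.P p.K) (k + 1) (SU N),
        chiSeqOfRecord F N θ.ν θ.τ9.M (gOfRecord₁₃ F N θ p) p.K (k + 1) s V' ≠ 0 →
          slotsTOfRecord F N θ.ν θ.τ9 (EOfRecord₁₃ F N θ) (wOfRecord₉ F N θ.toStage9Params) θ.ppSel p
              (gOfRecord₁₃ F N θ p) (k + 1) s V' =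
            sect2Slot F N (FluctV N) p.K (settingOfRecord₁₃ F N θ p) Rz' W s t E₀ (UbgOfRecord₁₃CoP F N θ p (k + 1) s) V' := by
  refine clause_succ_of_zetaSpecChiAt_of_clause θ p hk s hΩ W Rz t E₀ (UbgOfRecord₁₃CoP F N θ p k s.init) hid Rz' t E₀
    (UbgOfRecord₁₃CoP F N θ p (k + 1) s) (κ := 1) (c := 1) (one_mul 1) (fun S _ V' U₀ => ?_) (fun U₀ => by rw [hζχ U₀, one_mul]) hm hC
  rw [oldFactors_agree_of_Omega_empty θ p hM s hΩ W hζloc S (hwloc S) Rz Rz' t E₀ E₀ (hA S) V' U₀, sub_self, Real.exp_zero]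

end GeneralStep

/-! ## §3. ★★ Two weight families agreeing below generation `k` (the v1.7 situation: weights of `s′` vs weights of `init s′`) -/

section Prefix

variable (θ : Stage13Params F N) (p : B12.RunParams)

/-- **★★ THE GENERAL STEP ACROSS TWO WEIGHT FAMILIES AGREEING BELOW `k`.**  As §2, with the level-`k` dichotomy at `init s′` stated at the OLD weights `W₀` and
everything at `s′` at the NEW weights `W`, under `∀ j < k, W.ζ j = W₀.ζ j ∧ W.w j = W₀.w j` — the (PC) bridge (p536516: a length-`k` slot reads the weights below
generation `k` only); director-ym №186 (2): at print's witness this agreement is the statement «the component is untouched by R^{(k+1)}».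
[cite: Balaban1988Convergent, Theorem p.245, (3.24)–(3.25) p.270, (2.20)–(2.22) p.258; Balaban1989LargeFieldI, (0.2)–(0.3) p.176] -/
theorem clause_succ_of_Omega_empty_of_prefix_of_clause {k : ℕ} (hk : k < p.K) (hM : 1 ≤ θ.τ9.M)
    (s : SeqOfRecord F θ.ν θ.τ9.M (gOfRecord₁₃ F N θ p) p.K (k + 1)) (hΩ : s.Ω (k + 1) = ∅) (W W₀ : TkWeights F N (FluctV N) p.K)
    (hpre : ∀ j, j < k → W.ζ j = W₀.ζ j ∧ W.w j = W₀.w j)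
    (hζloc : ∀ j, j < k → ∀ ω ω' : MultiCfg (F.P p.K) (SU N) (FluctV N), (∀ i, i ≤ k → ω i = ω' i) →
      W.ζ j (s.init.Ω (j + 1))ᶜ ω = W.ζ j (s.init.Ω (j + 1))ᶜ ω')
    (hwloc : ∀ (S : ℕ → Set (Site (F.P p.K) 0)) (j : ℕ), j < k → ∀ ω ω' : MultiCfg (F.P p.K) (SU N) (FluctV N), (∀ i, i ≤ k → ω i = ω' i) →
      W.w j (s.init.Λ (j + 1)) ((s.init.Λ (j + 1))ᶜ ∩ s.init.Ω (j + 1)) (S (j + 1)) ω =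
        W.w j (s.init.Λ (j + 1)) ((s.init.Λ (j + 1))ᶜ ∩ s.init.Ω (j + 1)) (S (j + 1)) ω')
    (Rz Rz' : Sect2.Residual (F.P p.K) (MatA N)) (t : Sect2.TermValues (F.P p.K) (MatA N) (FluctV N) θ.τ9.M) (E₀ : ℝ)
    (hA : ∀ (S : ℕ → Set (Site (F.P p.K) 0)) (a a' : Tk.MSFluct (F.P p.K) (FluctV N)) (Uf : GaugeField (F.P p.K) 0 (SU N)), (∀ i, i ≤ k → a i = a' i) →
      (sect2ActionDataOfRecord F N (FluctV N) p.K (settingOfRecord₁₃ F N θ p) Rz s.init t (S, a) E₀).action23 k Uf =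
        (sect2ActionDataOfRecord F N (FluctV N) p.K (settingOfRecord₁₃ F N θ p) Rz s.init t (S, a') E₀).action23 k Uf)
    (hid : slotsOfRecord F N θ.ν θ.τ9 (EOfRecord₁₃ F N θ) (wOfRecord₉ F N θ.toStage9Params) θ.ppSel p (gOfRecord₁₃ F N θ p) k s.init = 0 ∨
      ∀ᵐ U₀ ∂fieldMeasure (F.P p.K) k (SU N),
        chiSeqOfRecord F N θ.ν θ.τ9.M (gOfRecord₁₃ F N θ p) p.K k s.init U₀ ≠ 0 →
          slotsOfRecord F N θ.ν θ.τ9 (EOfRecord₁₃ F N θ) (wOfRecord₉ F N θ.toStage9Params) θ.ppSel p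
              (gOfRecord₁₃ F N θ p) k s.init U₀ =
            sect2Slot F N (FluctV N) p.K (settingOfRecord₁₃ F N θ p) Rz W₀ s.init t E₀ (UbgOfRecord₁₃CoP F N θ p k s.init) U₀)
    (hζχ : ∀ U₀ : GaugeField (F.P p.K) k (SU N),
      W.ζ k Set.univ (pairCfgAt (V := FluctV N) k ((avOfRecord F N p.K k).avg U₀) U₀) *
          W.w k ∅ ∅ ∅ (pairCfgAt (V := FluctV N) k ((avOfRecord F N p.K k).avg U₀) U₀) =
        chiSeqOfRecord F N θ.ν θ.τ9.M (gOfRecord₁₃ F N θ p) p.K k s.init U₀ *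
          wOfRecord₉ F N θ.toStage9Params p (gOfRecord₁₃ F N θ p) k s U₀ ((avOfRecord F N p.K k).avg U₀))
    {C : ℝ}
    (hm : ∀ S ∈ admSOfRecord F θ.ν θ.τ9.M (gOfRecord₁₃ F N θ p) p.K k s.init,
      Measurable (Function.uncurry (noExpIntegrandAt F N (FluctV N) p.K k W
        (tkBranchOfRecord F N (FluctV N) θ.ν θ.τ9.M _ p.K W s.init S k
          (fun ω => sect2Operand F N (FluctV N) p.K (settingOfRecord₁₃ F N θ p) Rz' s t E₀ (UbgOfRecord₁₃CoP F N θ p (k + 1) s)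
            (S, fun j => (ω j).2) (fun j => (ω j).1))))))
    (hC : ∀ S ∈ admSOfRecord F θ.ν θ.τ9.M (gOfRecord₁₃ F N θ p) p.K k s.init, ∀ V' U₀,
      |noExpIntegrandAt F N (FluctV N) p.K k W
        (tkBranchOfRecord F N (FluctV N) θ.ν θ.τ9.M _ p.K W s.init S k
          (fun ω => sect2Operand F N (FluctV N) p.K (settingOfRecord₁₃ F N θ p) Rz' s t E₀ (UbgOfRecord₁₃CoP F N θ p (k + 1) s)
            (S, fun j => (ω j).2) (fun j => (ω j).1)))
        V' U₀| ≤ C) :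
    slotsTOfRecord F N θ.ν θ.τ9 (EOfRecord₁₃ F N θ) (wOfRecord₉ F N θ.toStage9Params) θ.ppSel p (gOfRecord₁₃ F N θ p) (k + 1) s = 0 ∨
      ∀ᵐ V' ∂fieldMeasure (F.P p.K) (k + 1) (SU N),
        chiSeqOfRecord F N θ.ν θ.τ9.M (gOfRecord₁₃ F N θ p) p.K (k + 1) s V' ≠ 0 →
          slotsTOfRecord F N θ.ν θ.τ9 (EOfRecord₁₃ F N θ) (wOfRecord₉ F N θ.toStage9Params) θ.ppSel p
              (gOfRecord₁₃ F N θ p) (k + 1) s V' =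
            sect2Slot F N (FluctV N) p.K (settingOfRecord₁₃ F N θ p) Rz' W s t E₀ (UbgOfRecord₁₃CoP F N θ p (k + 1) s) V' := by
  have hsl : sect2Slot F N (FluctV N) p.K (settingOfRecord₁₃ F N θ p) Rz W₀ s.init t E₀ (UbgOfRecord₁₃CoP F N θ p k s.init) =
      sect2Slot F N (FluctV N) p.K (settingOfRecord₁₃ F N θ p) Rz W s.init t E₀ (UbgOfRecord₁₃CoP F N θ p k s.init) :=
    (sect2Slot_congr_of_weights θ.ν θ.τ9.M (gOfRecord₁₃ F N θ p) p.K _ Rz W W₀ s.init t E₀ _ (fun j hj => (hpre j hj).1) (fun j hj => (hpre j hj).2)).symm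
  simp only [hsl] at hid
  exact clause_succ_of_Omega_empty_of_pinChi_of_clause θ p hk hM s hΩ W hζloc hwloc Rz Rz' t E₀ hA hid hζχ hm hC

end Prefix

end Summit.QuantumFields.YangMills.Theorems.BalabanUVNodesN11NoExpansionOldFactors

end
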